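import Literature.Barriers.QuantumFields.FiniteTemperatureReflection
import HarnessLib

/-!
# Time translations on Borgs–Seiler's finite-temperature lattice `ℤ_{L₀} × (ℤ/L)^d`

Topic `Literature/MathematicalPhysics/QuantumFieldTheory`; vocabulary of `Literature.Barriers.QuantumFields.FiniteTemperature*`
(configurations `Config d L₀ L G` on the links of `ℤ_{L₀} × (ℤ/L)^d`, time = the `none` direction, the Wilson weight
`weight ρ J_E J_M`, the a-priori measure `haar`, `timeHolonomy`, `polyakovLine`).  The tree has the SPATIAL translations
(`FiniteTemperature.translate`, `weight_translate`, `measurePreserving_translateEquiv` in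
`FiniteTemperatureDeconfinementInfrared.lean`); this companion supplies the translations along the (periodic) time circle,
needed to move Wilson loops between the reflection hyperplanes of the Tomboulis–Yaffe chain ("We impose periodic boundary
conditions in time"):

* `timeTranslate a` — `(τ_a U)((t, x), μ) = U((t + a, x), μ)`; `plaquette_timeTranslate`, `minusAction_timeTranslate`,
  `weight_timeTranslate` (the action is a sum over all sites); `timeTranslateEquiv`, `measurePreserving_timeTranslate(Equiv)`,
  `integral_comp_timeTranslate`, `integral_comp_timeTranslate_mul_weight` (invariance of `∏dg` and of weighted integrals);
* `timeHolonomy_timeTranslate`, `polyakovLine_timeTranslate`, and `trace_rep_timeHolonomy_period`: the trace of the Polyakov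
  loop does not depend on the time at which the closed product is started (cyclicity of the trace).

Everything is proved; finite-volume bookkeeping only (no estimate, nothing about confinement or a mass gap).

References: C. Borgs, E. Seiler, Commun. Math. Phys. 91 (1983) 329, §II.3 (II.20)–(II.22), Lemma II.4 (pp. 335–337).
-/

noncomputable section

open MeasureTheory
open Literature.MathematicalPhysics.QuantumFieldTheory (haarProbability)

namespace Literature.Barriers.QuantumFields

namespace FiniteTemperature

/-! ### Time translations -/

section TimeTranslate

variable {d L₀ L : ℕ} {G : Type*}

/-- The shift `(t, x) ↦ (t + a, x)` of sites along the time circle, as an equivalence. [folklore] -/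
def timeSiteShift (a : ZMod L₀) : Site d L₀ L ≃ Site d L₀ L :=
  Equiv.prodCongr (Equiv.addRight a) (Equiv.refl _)

/-- Pointwise form of `timeSiteShift`. [cite: BorgsSeiler1983, §II.3 (II.20)–(II.22) (pp. 335–337)] -/
@[simp] theorem timeSiteShift_apply (a : ZMod L₀) (x : Site d L₀ L) :
    timeSiteShift a x = (x.1 + a, x.2) := rfl

/-- The induced shift of links. [folklore] -/
def timeLinkShift (a : ZMod L₀) : (Site d L₀ L × Dir d) ≃ (Site d L₀ L × Dir d) :=
  Equiv.prodCongr (timeSiteShift a) (Equiv.refl _)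

/-- Pointwise form of `timeLinkShift`. [cite: BorgsSeiler1983, §II.3 (II.20)–(II.22) (pp. 335–337)] -/
@[simp] theorem timeLinkShift_apply (a : ZMod L₀) (e : Site d L₀ L × Dir d) :
    timeLinkShift a e = ((e.1.1 + a, e.1.2), e.2) := rfl

/-- The time shift commutes with the elementary steps `x ↦ x + e_μ`. [cite: BorgsSeiler1983, §II.3 (II.20)–(II.22) (pp. 335–337)] -/
theorem timeSiteShift_shift (a : ZMod L₀) (x : Site d L₀ L) (μ : Dir d) :
    (timeSiteShift (L := L) a x).shift μ = timeSiteShift a (x.shift μ) := by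
  cases μ with
  | none =>
      simp only [timeSiteShift_apply, Site.shift]
      rw [add_right_comm]
  | some i => rfl

/-- **Time translation of a configuration**: `(τ_a U)((t, x), μ) = U((t + a, x), μ)`. [folklore] -/
def timeTranslate (a : ZMod L₀) (U : Config d L₀ L G) : Config d L₀ L G :=
  fun e => U (timeLinkShift a e)

/-- Pointwise form of `timeTranslate`. [cite: BorgsSeiler1983, §II.3 (II.20)–(II.22) (pp. 335–337)] -/
@[simp] theorem timeTranslate_apply (a : ZMod L₀) (U : Config d L₀ L G) (x : Site d L₀ L) (μ : Dir d) :
    timeTranslate a U (x, μ) = U ((x.1 + a, x.2), μ) := rfl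

variable [Group G] {N : ℕ}

/-- Plaquettes of the time-translated configuration are time-translated plaquettes. [cite: BorgsSeiler1983, §II.3 (II.20)–(II.22) (pp. 335–337)] -/
theorem plaquette_timeTranslate (a : ZMod L₀) (U : Config d L₀ L G) (x : Site d L₀ L) (μ ν : Dir d) :
    plaquette (timeTranslate a U) x μ ν = plaquette U (timeSiteShift a x) μ ν := by
  unfold plaquette
  simp only [timeTranslate, timeLinkShift_apply]
  rw [← timeSiteShift_apply (L := L) a x, timeSiteShift_shift a x μ, timeSiteShift_shift a x ν]
  rfl

variable (ρ : G →* Matrix (Fin N) (Fin N) ℂ)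

/-- The Wilson action is invariant under time translations (reindex the sum over sites). [cite: BorgsSeiler1983, §II.3 (II.20)–(II.22) (pp. 335–337)] -/
theorem minusAction_timeTranslate [NeZero L₀] [NeZero L] (JE JM : ℝ) (a : ZMod L₀) (U : Config d L₀ L G) :
    minusAction ρ JE JM (timeTranslate a U) = minusAction ρ JE JM U := by
  unfold minusAction
  simp_rw [plaquette_timeTranslate]
  rw [Equiv.sum_comp (timeSiteShift (L := L) a)
      (fun x => ∑ i : Fin d, (ρ (plaquette U x none (some i))).trace.re),
    Equiv.sum_comp (timeSiteShift (L := L) a)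
      (fun x => ∑ p : {p : Fin d × Fin d // p.1 < p.2},
        (ρ (plaquette U x (some p.1.1) (some p.1.2))).trace.re)]

/-- Hence the Boltzmann weight is invariant under time translations. [cite: BorgsSeiler1983, §II.3 (II.20)–(II.22) (pp. 335–337)] -/
theorem weight_timeTranslate [NeZero L₀] [NeZero L] (JE JM : ℝ) (a : ZMod L₀) (U : Config d L₀ L G) :
    weight ρ JE JM (timeTranslate a U) = weight ρ JE JM U := by
  unfold weight; rw [minusAction_timeTranslate]

omit ρ in
/-- Time-like holonomies of the time-translated configuration. [cite: BorgsSeiler1983, §II.3 (II.20)–(II.22) (pp. 335–337)] -/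
theorem timeHolonomy_timeTranslate (a : ZMod L₀) (U : Config d L₀ L G) (k : ℕ) (t : ZMod L₀)
    (x : Fin d → ZMod L) :
    timeHolonomy (timeTranslate a U) k (t, x) = timeHolonomy U k (t + a, x) := by
  induction k generalizing t with
  | zero => rfl
  | succ k ih =>
      simp only [timeHolonomy, Site.shift, timeTranslate_apply]
      rw [ih, add_right_comm]

omit ρ in
/-- The Polyakov loop of the time-translated configuration is the Polyakov loop based at time `a`.
[cite: BorgsSeiler1983, §II.3 (II.20)–(II.22) (pp. 335–337)] -/
theorem polyakovLine_timeTranslate (a : ZMod L₀) (U : Config d L₀ L G) (x : Fin d → ZMod L) :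
    polyakovLine (timeTranslate a U) x = timeHolonomy U L₀ (a, x) := by
  unfold polyakovLine; rw [timeHolonomy_timeTranslate, zero_add]

/-- **The trace of the Polyakov loop does not depend on its base time**: for every natural `k`,
`tr ρ(timeHolonomy U L₀ (k, x)) = tr ρ(g_{L_x})` (the two closed products are cyclic permutations of each
other). [cite: BorgsSeiler1983, §II.3 Lemma II.4, Remark 1 (p. 336)] -/
theorem trace_rep_timeHolonomy_period [NeZero L₀] (U : Config d L₀ L G) (k : ℕ) (hk : k ≤ L₀)
    (x : Fin d → ZMod L) :
    (ρ (timeHolonomy U L₀ (((k : ℕ) : ZMod L₀), x))).trace = (ρ (polyakovLine U x)).trace := by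
  have h1 : timeHolonomy U L₀ ((0 : ZMod L₀), x) =
      timeHolonomy U k (0, x) * timeHolonomy U (L₀ - k) (((k : ℕ) : ZMod L₀), x) := by
    have h := timeHolonomy_add U k (L₀ - k) 0 x
    rw [Nat.add_sub_cancel' hk, zero_add] at h
    exact h
  have hk0 : (((k : ℕ) : ZMod L₀)) + (((L₀ - k : ℕ) : ZMod L₀)) = 0 := by
    rw [← Nat.cast_add, Nat.add_sub_cancel' hk, ZMod.natCast_self]
  have h2 : timeHolonomy U L₀ (((k : ℕ) : ZMod L₀), x) =
      timeHolonomy U (L₀ - k) (((k : ℕ) : ZMod L₀), x) * timeHolonomy U k (0, x) := by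
    have h := timeHolonomy_add U (L₀ - k) k (((k : ℕ) : ZMod L₀)) x
    rw [Nat.sub_add_cancel hk, hk0] at h
    exact h
  unfold polyakovLine
  rw [h1, h2, map_mul, map_mul, Matrix.trace_mul_comm]

variable [TopologicalSpace G] [IsTopologicalGroup G] [CompactSpace G] [MeasurableSpace G] [BorelSpace G]

omit ρ [Group G] [TopologicalSpace G] [IsTopologicalGroup G] [CompactSpace G] [BorelSpace G] in
/-- Time translation as a measurable equivalence (Mathlib's `MeasurableEquiv.piCongrLeft`). [folklore] -/
def timeTranslateEquiv (a : ZMod L₀) : Config d L₀ L G ≃ᵐ Config d L₀ L G :=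
  MeasurableEquiv.piCongrLeft (fun _ : Site d L₀ L × Dir d => G) (timeLinkShift a).symm

omit ρ [Group G] [TopologicalSpace G] [IsTopologicalGroup G] [CompactSpace G] [BorelSpace G] in
/-- The measurable equivalence is the time translation. [cite: BorgsSeiler1983, §II.3 (II.20)–(II.22) (pp. 335–337)] -/
theorem coe_timeTranslateEquiv (a : ZMod L₀) :
    ⇑(timeTranslateEquiv (d := d) (L₀ := L₀) (L := L) (G := G) a) = timeTranslate a := by
  funext U; funext e
  rw [timeTranslateEquiv, MeasurableEquiv.coe_piCongrLeft, Equiv.piCongrLeft_apply_eq_cast, cast_eq]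
  rfl

omit ρ in
/-- **Time translations preserve the a-priori measure** (a permutation of the factors). [cite: BorgsSeiler1983, §II.3 (II.20)–(II.22) (pp. 335–337)] -/
theorem measurePreserving_timeTranslateEquiv [NeZero L₀] [NeZero L] (a : ZMod L₀) :
    MeasurePreserving (timeTranslateEquiv (G := G) (d := d) (L := L) a) (haar d L₀ L G) (haar d L₀ L G) :=
  measurePreserving_piCongrLeft (fun _ : Site d L₀ L × Dir d => haarProbability G)
    (timeLinkShift (d := d) (L₀ := L₀) (L := L) a).symm

omit ρ in
/-- The time translation map preserves the a-priori measure. [cite: BorgsSeiler1983, §II.3 (II.20)–(II.22) (pp. 335–337)] -/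
theorem measurePreserving_timeTranslate [NeZero L₀] [NeZero L] (a : ZMod L₀) :
    MeasurePreserving (timeTranslate (G := G) (d := d) (L := L) a) (haar d L₀ L G) (haar d L₀ L G) := by
  have h := measurePreserving_timeTranslateEquiv (d := d) (L₀ := L₀) (L := L) (G := G) a
  rwa [coe_timeTranslateEquiv] at h

omit ρ in
/-- Change of variables by a time translation: `∫ f(τ_a U) ∏dg = ∫ f(U) ∏dg`. [cite: BorgsSeiler1983, §II.3 (II.20)–(II.22) (pp. 335–337)] -/
theorem integral_comp_timeTranslate [NeZero L₀] [NeZero L] {E : Type*} [NormedAddCommGroup E]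
    [NormedSpace ℝ E] (a : ZMod L₀) (f : Config d L₀ L G → E) :
    ∫ U, f (timeTranslate a U) ∂haar d L₀ L G = ∫ U, f U ∂haar d L₀ L G := by
  have h := (measurePreserving_timeTranslateEquiv (d := d) (L₀ := L₀) (L := L) (G := G) a).integral_comp' f
  rw [coe_timeTranslateEquiv] at h
  exact h

/-- **Time-translation invariance of weighted integrals**: `∫ f(τ_a U) e^{-S(U)} ∏dg = ∫ f(U) e^{-S(U)} ∏dg`.
[cite: BorgsSeiler1983, §II.3 (II.20)–(II.22) (pp. 335–337)] -/
theorem integral_comp_timeTranslate_mul_weight [NeZero L₀] [NeZero L] (JE JM : ℝ) (a : ZMod L₀)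
    (f : Config d L₀ L G → ℂ) :
    ∫ U, f (timeTranslate a U) * (weight ρ JE JM U : ℂ) ∂haar d L₀ L G =
      ∫ U, f U * (weight ρ JE JM U : ℂ) ∂haar d L₀ L G := by
  rw [← integral_comp_timeTranslate a (fun U => f U * (weight ρ JE JM U : ℂ))]
  simp_rw [weight_timeTranslate]

end TimeTranslate

end FiniteTemperature

end Literature.Barriers.QuantumFields

end
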